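import Literature.Algebra.Homology.DiscreteRepInflationQuotientExact
import Literature.Algebra.Homology.DiscreteRepLayerBoundary
import Literature.Algebra.Homology.ExtMapExactFunctorNaturality
import Literature.Algebra.Homology.RepExtGroupCohomologyRestriction
import HarnessLib

/-!
# Inflation in stages: `Γ ↠ Γ/N ↠ (Γ/N)/Ū` versus `Γ ↠ Γ/U`

Topic `Algebra/Homology`; namespace `Literature.Algebra.Homology.DiscreteRep`.  Pure homological
bookkeeping for the category `C_Γ = DiscreteRepCat k Γ` of discrete representations; no named fact, no
`instance`, no `sorry`.

Let `N ⊴ Γ` be a normal subgroup of a topological group (quotient topology on `Γ ⧸ N`), `Ū ⊴ Γ ⧸ N` an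
open normal subgroup of the quotient and `U ⊴ Γ` an open normal subgroup with `U ≤ π⁻¹(Ū)`
(`π : Γ ↠ Γ ⧸ N`), so that `π` induces `θ : Γ ⧸ U →* (Γ ⧸ N) ⧸ Ū` (`stageMap`).  For a discrete
`Γ ⧸ N`-representation `Y` there are two ways to inflate a class of the finite layer
`Hⁿ((Γ⧸N)⧸Ū, Y^Ū)` to `Extⁿ_{C_Γ}(k, Inf_N Y)`:

* inflate to `Extⁿ_{C_{Γ/N}}(k, Y)` by door-c4's layer inflation `inflG Ū` (resp. `extInf Ū` in `Ext`
  currency) and then to `C_Γ` by the exact functor `Inf_N = inflQuotFunctor k N` (`inflExtHom N`);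
* pull the class back along `θ` to the layer `Hⁿ(Γ⧸U, (Inf_N Y)^U)` of `Γ` (Mathlib's
  `groupCohomology.map θ ψ`, `ψ : res_θ (Y^Ū) ⟶ (Inf_N Y)^U` the identity on vectors) and inflate by
  `inflG U`.

**Main results.**
* `infFunctor_comp_inflQuotFunctor` — the two composite inflation functors
  `Rep k ((Γ⧸N)⧸Ū) ⥤ C_Γ` agree *definitionally*: `Inf_Ū ⋙ Inf_N = res_θ ⋙ Inf_U`.
* `inflExtHomTriv_extInf` / `inflExtHom_extInf` — **inflation in stages on `Ext`**:
  `Inf_N (extInf Ū y) = extInf U (res_θ y ≫ ψ)`.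
* `LayerColimit.inflExtHomTriv_inflG` — the same in `groupCohomology` currency:
  `Inf_N (inflG Ū Y n c) = inflG U (Inf_N Y) n (Hⁿ(θ, ψ) c)`;
  `…_comp_mk₀` / `…_comp_mk₀'` — followed by a morphism `φ : Inf_N Y ⟶ M` of `C_Γ`;
  `…_comp_mk₀_invariantsInclQuot` — the case `Y = M^N`, `φ` the counit `Inf_N(M^N) ⟶ M`;
  `exists_inflExtHomTriv_eq_inflG` — every `Inf_N x` is so obtained (`Γ ⧸ N` profinite).
* `inflExtHomTriv N Y n` — `inflExtHom N (triv k) Y n` retyped along `Inf_N (triv k) = triv k` (rfl);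
  `stagePullback` / `LayerColimit.stageG` — the pull-back to the `Γ`-layer on `Ext` / on `Hⁿ`, identified by
  the dictionary (`extTrivialAddEquivGroupCohomology_stagePullback`); `LayerColimit.stagePreimage N Ū = π⁻¹(Ū)`.

These are the generic half of the comparison «invariant map of `(G_S, C_{K_S})` = invariant map of
`(Γ_K, C̄)` after inflation» (Poitou–Tate for `G_S` on the `Ext` road, crux
`stmt-BirchSwinnertonDyer-19032`, lane PT-Ш-S-TC, step (★2) of the `(R4)_S` plan): both invariant maps
are `LayerColimit.desc`s of layer invariants, and the present file says how a `G_S`-layer class sits in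
the `Γ_K`-layers.  HONEST FRAMING: homological algebra only; no arithmetic statement and no case of BSD
is proved here.

## References
* J.-P. Serre, *Galois Cohomology*, Springer (1997), I §2.2 Proposition 8 (cohomology of a profinite
  group as the direct limit over finite layers; compatibility of inflations). [SerreGaloisCohomology1997]
* D. Harari, *Galois Cohomology and Class Field Theory*, Universitext (2020), §4.3 Remark 4.24
  (inflation for discrete modules), §1.5 (functoriality `(θ, ψ)^*`). [Harari2020]
* K. S. Brown, *Cohomology of Groups*, GTM 87 (1982), III §8 (functoriality of cohomology in the pair
  `(group map, module map)`). [Brown1982CohomologyGroups]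
* C. A. Weibel, *An introduction to homological algebra*, CUP (1994), §2.4 Exercise 2.4.3
  (dimension shifting; functoriality of `Ext` in exact functors). [Weibel1994]
-/

noncomputable section

universe u

namespace Literature.Algebra.Homology

namespace DiscreteRep

open CategoryTheory CategoryTheory.Limits CategoryTheory.Abelian

variable {k Γ : Type u} [CommRing k] [Group Γ] [TopologicalSpace Γ] [IsTopologicalGroup Γ]
variable (N : Subgroup Γ) [N.Normal]

/-! ## §1 The stage map `θ : Γ ⧸ U →* (Γ ⧸ N) ⧸ Ū` and the two inflation functors -/

section Subgroups

variable (U : Subgroup Γ) [U.Normal] (hU : IsOpen (U : Set Γ))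
  (Ū : Subgroup (Γ ⧸ N)) [Ū.Normal] (hŪ : IsOpen (Ū : Set (Γ ⧸ N)))
  (hle : U ≤ Ū.comap (QuotientGroup.mk' N))

/-- **The stage map `θ : Γ ⧸ U →* (Γ ⧸ N) ⧸ Ū`** induced by `Γ ↠ Γ ⧸ N` (for `U ≤ π⁻¹(Ū)`).
[cite: SerreGaloisCohomology1997, I §2.2 Proposition 8] -/
def stageMap : Γ ⧸ U →* (Γ ⧸ N) ⧸ Ū :=
  QuotientGroup.map U Ū (QuotientGroup.mk' N) hle

omit [TopologicalSpace Γ] [IsTopologicalGroup Γ] in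
/-- `θ (γ mod U) = (γ mod N) mod Ū` (definitionally). [cite: SerreGaloisCohomology1997, I §2.2 Proposition 8] -/
@[simp]
theorem stageMap_mk (γ : Γ) :
    stageMap N U Ū hle (QuotientGroup.mk γ) = QuotientGroup.mk (QuotientGroup.mk γ) := rfl

/-- **The two composite inflation functors agree definitionally**:
`Inf_Ū ⋙ Inf_N = res_θ ⋙ Inf_U : Rep k ((Γ⧸N)⧸Ū) ⥤ C_Γ` (both send `B` to `B` with `γ` acting through
`(γ mod N) mod Ū = θ (γ mod U)`). [cite: Harari2020, §4.3 Remark 4.24] -/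
theorem infFunctor_comp_inflQuotFunctor :
    infFunctor k Ū hŪ ⋙ inflQuotFunctor k N = Rep.resFunctor (stageMap N U Ū hle) ⋙ infFunctor k U hU :=
  rfl

omit [IsTopologicalGroup Γ] in
/-- `Inf_N` of the trivial representation is the trivial representation (definitionally).
[cite: Harari2020, §4.3 Remark 4.24] -/
theorem inflQuotFunctor_obj_triv (V : Type u) [AddCommGroup V] [Module k V] :
    (inflQuotFunctor k N).obj (triv (Γ := Γ ⧸ N) (k := k) V) = triv (Γ := Γ) (k := k) V := rfl

omit [TopologicalSpace Γ] [IsTopologicalGroup Γ] [U.Normal] in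
include hle in
/-- A `Ū`-invariant vector of `Y` is `U`-invariant in `Inf_N Y`. [cite: Harari2020, §4.3 Remark 4.24] -/
theorem mem_invariants_infl_of_mem (Y : Rep.{u} k (Γ ⧸ N)) (x : (Y.quotientToInvariants Ū).V) :
    (x.1 : (Rep.res (QuotientGroup.mk' N) Y).V) ∈
      Representation.invariants ((Rep.res (QuotientGroup.mk' N) Y).ρ.comp U.subtype) := fun u =>
  x.2 ⟨QuotientGroup.mk' N u.1, hle u.2⟩

/-- **`ψ : res_θ (Y^Ū) ⟶ (Inf_N Y)^U`**, the identity on vectors, a morphism of `Rep k (Γ ⧸ U)`.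
[cite: Harari2020, §4.3 Remark 4.24][cite: Brown1982CohomologyGroups, III §8] -/
def stageInvariantsIncl (Y : DiscreteRepCat k (Γ ⧸ N)) :
    (Rep.resFunctor (stageMap N U Ū hle)).obj ((invariantsQuotFunctor k Ū).obj Y) ⟶
      (invariantsQuotFunctor k U).obj ((inflQuotFunctor k N).obj Y) :=
  Rep.ofHom
    ⟨{ toFun := fun x => ⟨x.1, mem_invariants_infl_of_mem N U Ū hle Y.obj x⟩
       map_add' := fun _ _ => rfl
       map_smul' := fun _ _ => rfl },
     fun q => QuotientGroup.induction_on q fun _ => LinearMap.ext fun _ => Subtype.ext rfl⟩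

omit [IsTopologicalGroup Γ] in
/-- Formula: `ψ` is `x ↦ x` on underlying vectors. [cite: Harari2020, §4.3 Remark 4.24] -/
@[simp]
theorem stageInvariantsIncl_hom_apply_coe (Y : DiscreteRepCat k (Γ ⧸ N))
    (x : (Y.obj.quotientToInvariants Ū).V) :
    ((stageInvariantsIncl N U Ū hle Y).hom x).1 = x.1 := rfl

omit [IsTopologicalGroup Γ] in
/-- Naturality of `ψ` in `Y`. [cite: Harari2020, §4.3 Remark 4.24] -/
theorem stageInvariantsIncl_naturality {Y Y' : DiscreteRepCat k (Γ ⧸ N)} (g : Y ⟶ Y') :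
    (Rep.resFunctor (stageMap N U Ū hle)).map ((invariantsQuotFunctor k Ū).map g) ≫
        stageInvariantsIncl N U Ū hle Y' =
      stageInvariantsIncl N U Ū hle Y ≫
        (invariantsQuotFunctor k U).map ((inflQuotFunctor k N).map g) :=
  Rep.hom_ext (DFunLike.ext _ _ fun _ => Subtype.ext rfl)

/-- **`Inf_N (incl_Ū) = Inf_U (ψ) ≫ incl_U`** as morphisms `Inf_N Inf_Ū (Y^Ū) ⟶ Inf_N Y` of `C_Γ`
(all three are `x ↦ x` on vectors). [cite: Harari2020, §4.3 Remark 4.24] -/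
theorem inflQuotFunctor_map_invariantsIncl (Y : DiscreteRepCat k (Γ ⧸ N)) :
    (inflQuotFunctor k N).map (invariantsIncl Ū hŪ Y) =
      (infFunctor k U hU).map (stageInvariantsIncl N U Ū hle Y) ≫
        invariantsIncl U hU ((inflQuotFunctor k N).obj Y) :=
  ObjectProperty.hom_ext _ (Rep.hom_ext (DFunLike.ext _ _ fun _ => rfl))

/-- **Pull-back to the `Γ`-layer on `Ext`**: `Extⁿ_{Rep k ((Γ⧸N)⧸Ū)}(k, Y^Ū) →+ Extⁿ_{Rep k (Γ⧸U)}(k, (Inf_N Y)^U)`,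
`y ↦ res_θ(y) ≫ ψ` (restriction along `θ` is exact). [cite: Brown1982CohomologyGroups, III §8][cite: Weibel1994, §2.4 Exercise 2.4.3] -/
def stagePullback (Y : DiscreteRepCat k (Γ ⧸ N)) (n : ℕ) :
    Ext (Rep.trivial k ((Γ ⧸ N) ⧸ Ū) k) ((invariantsQuotFunctor k Ū).obj Y) n →+
      Ext (Rep.trivial k (Γ ⧸ U) k) ((invariantsQuotFunctor k U).obj ((inflQuotFunctor k N).obj Y)) n :=
  ((Ext.mk₀ (stageInvariantsIncl N U Ū hle Y)).postcomp _ (add_zero n)).comp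
    ((Rep.resFunctor (stageMap N U Ū hle)).mapExtAddHom _ _ n)

omit [IsTopologicalGroup Γ] in
/-- Formula for `stagePullback`. [cite: Brown1982CohomologyGroups, III §8] -/
theorem stagePullback_apply (Y : DiscreteRepCat k (Γ ⧸ N)) (n : ℕ)
    (y : Ext (Rep.trivial k ((Γ ⧸ N) ⧸ Ū) k) ((invariantsQuotFunctor k Ū).obj Y) n) :
    stagePullback N U Ū hle Y n y =
      (y.mapExactFunctor (Rep.resFunctor (stageMap N U Ū hle))).comp
        (Ext.mk₀ (stageInvariantsIncl N U Ū hle Y)) (add_zero n) := rfl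

omit [IsTopologicalGroup Γ] in
/-- **Under the dictionary `E = RepExt.extTrivialAddEquivGroupCohomology`, `stagePullback` is Mathlib's
`groupCohomology.map θ ψ`** (functoriality of inhomogeneous cochains in the pair `(θ, ψ)`).
[cite: Brown1982CohomologyGroups, III §8] -/
theorem extTrivialAddEquivGroupCohomology_stagePullback (Y : DiscreteRepCat k (Γ ⧸ N)) (n : ℕ)
    (y : Ext (Rep.trivial k ((Γ ⧸ N) ⧸ Ū) k) ((invariantsQuotFunctor k Ū).obj Y) n) :
    RepExt.extTrivialAddEquivGroupCohomology _ n (stagePullback N U Ū hle Y n y) =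
      groupCohomology.map (stageMap N U Ū hle) (stageInvariantsIncl N U Ū hle Y) n
        (RepExt.extTrivialAddEquivGroupCohomology ((invariantsQuotFunctor k Ū).obj Y) n y) := by
  rw [stagePullback_apply]
  exact RepExt.extTrivialAddEquivGroupCohomology_mapExactFunctor_comp (stageMap N U Ū hle)
    (stageInvariantsIncl N U Ū hle Y) y

omit [IsTopologicalGroup Γ] in
/-- Inverse form: `E⁻¹ (groupCohomology.map θ ψ n c) = stagePullback (E⁻¹ c)`.
[cite: Brown1982CohomologyGroups, III §8] -/
theorem extTrivialAddEquivGroupCohomology_symm_map_stage (Y : DiscreteRepCat k (Γ ⧸ N)) (n : ℕ)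
    (c : groupCohomology ((invariantsQuotFunctor k Ū).obj Y) n) :
    (RepExt.extTrivialAddEquivGroupCohomology
        ((invariantsQuotFunctor k U).obj ((inflQuotFunctor k N).obj Y)) n).symm
        (groupCohomology.map (stageMap N U Ū hle) (stageInvariantsIncl N U Ū hle Y) n c) =
      stagePullback N U Ū hle Y n ((RepExt.extTrivialAddEquivGroupCohomology _ n).symm c) := by
  apply (RepExt.extTrivialAddEquivGroupCohomology
    ((invariantsQuotFunctor k U).obj ((inflQuotFunctor k N).obj Y)) n).injective
  rw [AddEquiv.apply_symm_apply, extTrivialAddEquivGroupCohomology_stagePullback,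
    AddEquiv.apply_symm_apply]

omit [TopologicalSpace Γ] [IsTopologicalGroup Γ] in
/-- `Hⁿ(θ, ψ) ≫ Hⁿ(id, χ) = Hⁿ(θ, ψ ≫ χ)` (Mathlib's `groupCohomology.map_comp` with the identity).
[cite: Brown1982CohomologyGroups, III §8] -/
theorem groupCohomology_map_comp_map_id {A : Rep.{u} k ((Γ ⧸ N) ⧸ Ū)} {B C : Rep.{u} k (Γ ⧸ U)}
    (ψ : (Rep.resFunctor (stageMap N U Ū hle)).obj A ⟶ B) (χ : B ⟶ C) (n : ℕ) :
    groupCohomology.map (stageMap N U Ū hle) ψ n ≫ groupCohomology.map (MonoidHom.id _) χ n =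
      groupCohomology.map (stageMap N U Ū hle) (ψ ≫ χ) n := by
  rw [← groupCohomology.map_comp]
  rfl

/-! ## §2 Inflation in stages on `Ext` -/

/-- **Inflation `Extⁿ_{C_{Γ/N}}(k, Y) →+ Extⁿ_{C_Γ}(k, Inf_N Y)` with trivial source**: `inflExtHom N (triv k) Y n`
retyped along `Inf_N (triv k) = triv k` (definitional), so that its values compose with classes out of
`triv k` without casts. [cite: Harari2020, §4.3 Remark 4.24][cite: Weibel1994, §10.7] -/
def inflExtHomTriv (Y : DiscreteRepCat k (Γ ⧸ N)) (n : ℕ) :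
    Ext (triv (Γ := Γ ⧸ N) k) Y n →+ Ext (triv (Γ := Γ) k) ((inflQuotFunctor k N).obj Y) n :=
  inflExtHom N (triv k) Y n

/-- `inflExtHomTriv` is `inflExtHom` (definitionally). [cite: Weibel1994, §10.7] -/
theorem inflExtHomTriv_apply (Y : DiscreteRepCat k (Γ ⧸ N)) (n : ℕ) (x : Ext (triv (Γ := Γ ⧸ N) k) Y n) :
    inflExtHomTriv N Y n x = inflExtHom N (triv k) Y n x := rfl

/-- `inflExtHomTriv` as `Ext.mapExactFunctor`. [cite: Weibel1994, §10.7] -/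
theorem inflExtHomTriv_eq_mapExactFunctor (Y : DiscreteRepCat k (Γ ⧸ N)) (n : ℕ)
    (x : Ext (triv (Γ := Γ ⧸ N) k) Y n) :
    inflExtHomTriv N Y n x =
      (haveI := preservesFiniteLimits_inflQuotFunctor (k := k) N
       haveI := preservesFiniteColimits_inflQuotFunctor (k := k) N
       x.mapExactFunctor (inflQuotFunctor k N)) := rfl

/-- **Inflation in stages on `Ext`.**  For `y ∈ Extⁿ_{Rep k ((Γ⧸N)⧸Ū)}(k, Y^Ū)`:
`Inf_N (extInf Ū y) = extInf U (res_θ (y) ≫ ψ)` in `Extⁿ_{C_Γ}(k, Inf_N Y)` — inflating from the layer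
`Ū` of `Γ ⧸ N` to `C_{Γ/N}` and then along `Γ ↠ Γ ⧸ N` is inflating the pulled-back class from the
layer `U` of `Γ`.  (`Ext.mapExactFunctor` is compatible with composition of exact functors, and the two
composite functors agree.) [cite: SerreGaloisCohomology1997, I §2.2 Proposition 8][cite: Weibel1994, §2.4 Exercise 2.4.3] -/
theorem inflExtHomTriv_extInf (Y : DiscreteRepCat k (Γ ⧸ N)) (n : ℕ)
    (y : Ext (Rep.trivial k ((Γ ⧸ N) ⧸ Ū) k) ((invariantsQuotFunctor k Ū).obj Y) n) :
    inflExtHomTriv N Y n (extInf Ū hŪ Y n y) =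
      extInf U hU ((inflQuotFunctor k N).obj Y) n (stagePullback N U Ū hle Y n y) := by
  haveI := preservesFiniteLimits_inflQuotFunctor (k := k) N
  haveI := preservesFiniteColimits_inflQuotFunctor (k := k) N
  haveI := comp_preservesFiniteLimits (infFunctor k Ū hŪ) (inflQuotFunctor k N)
  haveI := comp_preservesFiniteColimits (infFunctor k Ū hŪ) (inflQuotFunctor k N)
  haveI := comp_preservesFiniteLimits (Rep.resFunctor (stageMap N U Ū hle)) (infFunctor k U hU)
  haveI := comp_preservesFiniteColimits (Rep.resFunctor (stageMap N U Ū hle)) (infFunctor k U hU)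
  change ((y.mapExactFunctor (infFunctor k Ū hŪ)).comp (Ext.mk₀ (invariantsIncl Ū hŪ Y))
      (add_zero n)).mapExactFunctor (inflQuotFunctor k N) =
    (((y.mapExactFunctor (Rep.resFunctor (stageMap N U Ū hle))).comp
        (Ext.mk₀ (stageInvariantsIncl N U Ū hle Y)) (add_zero n)).mapExactFunctor
        (infFunctor k U hU)).comp
      (Ext.mk₀ (invariantsIncl U hU ((inflQuotFunctor k N).obj Y))) (add_zero n)
  rw [Ext.mapExactFunctor_comp, Ext.mapExactFunctor_mk₀,
    ← ExtFunctoriality.mapExactFunctor_comp_functor, Ext.mapExactFunctor_comp,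
    Ext.mapExactFunctor_mk₀, ← ExtFunctoriality.mapExactFunctor_comp_functor,
    Ext.comp_assoc_of_third_deg_zero, Ext.mk₀_comp_mk₀,
    ← inflQuotFunctor_map_invariantsIncl N U hU Ū hŪ hle Y]
  rfl

/-- The same statement typed with `inflExtHom N (triv k)`. [cite: SerreGaloisCohomology1997, I §2.2 Proposition 8] -/
theorem inflExtHom_extInf (Y : DiscreteRepCat k (Γ ⧸ N)) (n : ℕ)
    (y : Ext (Rep.trivial k ((Γ ⧸ N) ⧸ Ū) k) ((invariantsQuotFunctor k Ū).obj Y) n) :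
    inflExtHom N (triv k) Y n (extInf Ū hŪ Y n y) =
      extInf U hU ((inflQuotFunctor k N).obj Y) n (stagePullback N U Ū hle Y n y) :=
  inflExtHomTriv_extInf N U hU Ū hŪ hle Y n y

/-- Variant followed by a morphism `φ : Inf_N Y ⟶ M` of `C_Γ`:
`Inf_N (extInf Ū y) ≫ φ = extInf U (res_θ (y) ≫ ψ ≫ φ^U)` in `Extⁿ_{C_Γ}(k, M)`.
[cite: SerreGaloisCohomology1997, I §2.2 Proposition 8][cite: Harari2020, §4.3 Remark 4.24] -/
theorem inflExtHomTriv_extInf_comp_mk₀ (Y : DiscreteRepCat k (Γ ⧸ N)) {M : DiscreteRepCat k Γ}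
    (φ : (inflQuotFunctor k N).obj Y ⟶ M) (n : ℕ)
    (y : Ext (Rep.trivial k ((Γ ⧸ N) ⧸ Ū) k) ((invariantsQuotFunctor k Ū).obj Y) n) :
    (inflExtHomTriv N Y n (extInf Ū hŪ Y n y)).comp (Ext.mk₀ φ) (add_zero n) =
      extInf U hU M n
        ((stagePullback N U Ū hle Y n y).comp (Ext.mk₀ ((invariantsQuotFunctor k U).map φ))
          (add_zero n)) := by
  rw [inflExtHomTriv_extInf N U hU Ū hŪ hle Y n y, extInf_naturality]

end Subgroups

/-! ## §3 Inflation in stages in `groupCohomology` currency -/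

namespace LayerColimit

/-- **The preimage layer `π⁻¹(Ū) ⊴ Γ`** of an open normal subgroup `Ū ⊴ Γ ⧸ N` (open by continuity of
`π`, normal as a preimage). [cite: SerreGaloisCohomology1997, I §2.2 Proposition 8] -/
def stagePreimage (Ū : OpenNormalSubgroup (Γ ⧸ N)) : OpenNormalSubgroup Γ :=
  { toOpenSubgroup := Ū.toOpenSubgroup.comap (QuotientGroup.mk' N) QuotientGroup.continuous_mk
    isNormal' := inferInstanceAs ((Ū : Subgroup (Γ ⧸ N)).comap (QuotientGroup.mk' N)).Normal }

omit [IsTopologicalGroup Γ] in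
/-- As a subgroup, `stagePreimage N Ū = π⁻¹(Ū)`. [cite: SerreGaloisCohomology1997, I §2.2 Proposition 8] -/
theorem coe_stagePreimage (Ū : OpenNormalSubgroup (Γ ⧸ N)) :
    (stagePreimage N Ū : Subgroup Γ) = (Ū : Subgroup (Γ ⧸ N)).comap (QuotientGroup.mk' N) := rfl

omit [IsTopologicalGroup Γ] in
/-- `N ≤ π⁻¹(Ū)`. [cite: SerreGaloisCohomology1997, I §2.2 Proposition 8] -/
theorem le_stagePreimage (Ū : OpenNormalSubgroup (Γ ⧸ N)) : N ≤ (stagePreimage N Ū : Subgroup Γ) := by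
  intro g hg
  change QuotientGroup.mk' N g ∈ (Ū : Subgroup (Γ ⧸ N))
  rw [QuotientGroup.mk'_apply, (QuotientGroup.eq_one_iff g).2 hg]
  exact one_mem _

section Layers

variable (U : OpenNormalSubgroup Γ) (Ū : OpenNormalSubgroup (Γ ⧸ N))
  (hle : (U : Subgroup Γ) ≤ (Ū : Subgroup (Γ ⧸ N)).comap (QuotientGroup.mk' N))

/-- **The pull-back `Hⁿ(θ, ψ) : Hⁿ((Γ⧸N)⧸Ū, Y^Ū) ⟶ Hⁿ(Γ⧸U, (Inf_N Y)^U)`** (Mathlib's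
`groupCohomology.map θ ψ n`). [cite: Brown1982CohomologyGroups, III §8] -/
abbrev stageG (Y : DiscreteRepCat k (Γ ⧸ N)) (n : ℕ) :
    groupCohomology ((invariantsQuotFunctor k (Ū : Subgroup (Γ ⧸ N))).obj Y) n ⟶
      groupCohomology ((invariantsQuotFunctor k (U : Subgroup Γ)).obj ((inflQuotFunctor k N).obj Y)) n :=
  groupCohomology.map (stageMap N U Ū hle) (stageInvariantsIncl N U Ū hle Y) n

omit [IsTopologicalGroup Γ] in
/-- **`E_U⁻¹ (stageG c) = stagePullback (E_Ū⁻¹ c)`.** [cite: Brown1982CohomologyGroups, III §8] -/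
theorem layerE_symm_stageG (Y : DiscreteRepCat k (Γ ⧸ N)) (n : ℕ)
    (c : groupCohomology ((invariantsQuotFunctor k (Ū : Subgroup (Γ ⧸ N))).obj Y) n) :
    (layerE U ((inflQuotFunctor k N).obj Y) n).symm (stageG N U Ū hle Y n c) =
      stagePullback N U Ū hle Y n ((layerE Ū Y n).symm c) :=
  extTrivialAddEquivGroupCohomology_symm_map_stage N U Ū hle Y n c

/-- **Inflation in stages, `groupCohomology` currency.**  For `c ∈ Hⁿ((Γ⧸N)⧸Ū, Y^Ū)`:
`Inf_N (inflG Ū Y n c) = inflG U (Inf_N Y) n (Hⁿ(θ, ψ) c)`, where `Hⁿ(θ, ψ) = stageG = groupCohomology.map θ ψ n`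
is Mathlib's functoriality in the pair `(θ : Γ⧸U → (Γ⧸N)⧸Ū, ψ : Y^Ū ⊆ (Inf_N Y)^U)`.
[cite: SerreGaloisCohomology1997, I §2.2 Proposition 8][cite: Brown1982CohomologyGroups, III §8] -/
theorem inflExtHomTriv_inflG (Y : DiscreteRepCat k (Γ ⧸ N)) (n : ℕ)
    (c : groupCohomology ((invariantsQuotFunctor k (Ū : Subgroup (Γ ⧸ N))).obj Y) n) :
    inflExtHomTriv N Y n (inflG Ū Y n c) =
      inflG U ((inflQuotFunctor k N).obj Y) n (stageG N U Ū hle Y n c) := by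
  rw [inflG_apply, inflG_apply, layerE_symm_stageG]
  exact inflExtHomTriv_extInf N U (coe_isOpen U) Ū (coe_isOpen Ū) hle Y n _

/-- **Inflation in stages followed by `φ : Inf_N Y ⟶ M`**:
`Inf_N (inflG Ū Y n c) ≫ φ = inflG U M n (Hⁿ(id, φ^U) (Hⁿ(θ, ψ) c))`.
[cite: SerreGaloisCohomology1997, I §2.2 Proposition 8][cite: Brown1982CohomologyGroups, III §8] -/
theorem inflExtHomTriv_inflG_comp_mk₀ (Y : DiscreteRepCat k (Γ ⧸ N)) {M : DiscreteRepCat k Γ}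
    (φ : (inflQuotFunctor k N).obj Y ⟶ M) (n : ℕ)
    (c : groupCohomology ((invariantsQuotFunctor k (Ū : Subgroup (Γ ⧸ N))).obj Y) n) :
    (inflExtHomTriv N Y n (inflG Ū Y n c)).comp (Ext.mk₀ φ) (add_zero n) =
      inflG U M n
        ((groupCohomology.map (MonoidHom.id _)
          ((invariantsQuotFunctor k (U : Subgroup Γ)).map φ) n).hom (stageG N U Ū hle Y n c)) := by
  rw [inflG_map, inflExtHomTriv_inflG]

/-- The same with the two coefficient maps fused: `Inf_N (inflG Ū Y n c) ≫ φ = inflG U M n (Hⁿ(θ, ψ ≫ φ^U) c)`.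
[cite: SerreGaloisCohomology1997, I §2.2 Proposition 8][cite: Brown1982CohomologyGroups, III §8] -/
theorem inflExtHomTriv_inflG_comp_mk₀' (Y : DiscreteRepCat k (Γ ⧸ N)) {M : DiscreteRepCat k Γ}
    (φ : (inflQuotFunctor k N).obj Y ⟶ M) (n : ℕ)
    (c : groupCohomology ((invariantsQuotFunctor k (Ū : Subgroup (Γ ⧸ N))).obj Y) n) :
    (inflExtHomTriv N Y n (inflG Ū Y n c)).comp (Ext.mk₀ φ) (add_zero n) =
      inflG U M n
        (groupCohomology.map (stageMap N U Ū hle)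
          (stageInvariantsIncl N U Ū hle Y ≫ (invariantsQuotFunctor k (U : Subgroup Γ)).map φ) n c) := by
  rw [inflExtHomTriv_inflG_comp_mk₀ N U Ū hle, ← groupCohomology_map_comp_map_id,
    ModuleCat.comp_apply]

/-- **The case of the counit.**  For `M ∈ C_Γ`, `Y = M^N ∈ C_{Γ/N}` and `φ = incl : Inf_N(M^N) ⟶ M`:
`Inf_N (inflG Ū (M^N) n c) ≫ incl = inflG U M n (Hⁿ(θ, (M^N)^Ū ⊆ M^U) c)` — a class of the layer `Ū`
of the `Γ ⧸ N`-module `M^N`, inflated to `C_{Γ/N}`, then to `C_Γ` and pushed into `M`, is the class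
of the layer `U` of `M` obtained by pull-back along `θ`. [cite: SerreGaloisCohomology1997, I §2.2 Proposition 8] -/
theorem inflExtHomTriv_inflG_comp_mk₀_invariantsInclQuot (M : DiscreteRepCat k Γ) (n : ℕ)
    (c : groupCohomology
      ((invariantsQuotFunctor k (Ū : Subgroup (Γ ⧸ N))).obj ((invariantsQuotD k N).obj M)) n) :
    (inflExtHomTriv N ((invariantsQuotD k N).obj M) n
        (inflG Ū ((invariantsQuotD k N).obj M) n c)).comp
        (Ext.mk₀ (invariantsInclQuot N M)) (add_zero n) =
      inflG U M n
        (groupCohomology.map (stageMap N U Ū hle)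
          (stageInvariantsIncl N U Ū hle ((invariantsQuotD k N).obj M) ≫
            (invariantsQuotFunctor k (U : Subgroup Γ)).map (invariantsInclQuot N M)) n c) :=
  inflExtHomTriv_inflG_comp_mk₀' N U Ū hle _ (invariantsInclQuot N M) n c

/-- Formula for the coefficient map of the counit case: `x ↦ x` on vectors of `M`.
[cite: Harari2020, §4.3 Remark 4.24] -/
@[simp]
theorem stageInvariantsIncl_comp_map_invariantsInclQuot_hom_apply_coe (M : DiscreteRepCat k Γ)
    (x : (((invariantsQuotD k N).obj M).obj.quotientToInvariants (Ū : Subgroup (Γ ⧸ N))).V) :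
    ((stageInvariantsIncl N U Ū hle ((invariantsQuotD k N).obj M) ≫
        (invariantsQuotFunctor k (U : Subgroup Γ)).map (invariantsInclQuot N M)).hom x).1 = x.1.1 :=
  rfl

end Layers

/-- **Every class inflated from `C_{Γ/N}` is inflated from a layer of `Γ` pulled back from a layer of
`Γ ⧸ N`**: for `x ∈ Extⁿ_{C_{Γ/N}}(k, Y)` there are an open normal `Ū ≤ Γ ⧸ N` and
`c ∈ Hⁿ((Γ⧸N)⧸Ū, Y^Ū)` with `inflG Ū Y n c = x` and `Inf_N x = inflG (π⁻¹ Ū) (Inf_N Y) n (Hⁿ(θ, ψ) c)`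
(`Γ ⧸ N` profinite; door-c4's exhaustion `exists_inflG_eq` over `Γ ⧸ N`).
[cite: SerreGaloisCohomology1997, I §2.2 Proposition 8] -/
theorem exists_inflExtHomTriv_eq_inflG [CompactSpace (Γ ⧸ N)] [TotallyDisconnectedSpace (Γ ⧸ N)]
    (Y : DiscreteRepCat k (Γ ⧸ N)) (n : ℕ) (x : Ext (triv (Γ := Γ ⧸ N) k) Y n) :
    ∃ (Ū : OpenNormalSubgroup (Γ ⧸ N))
      (c : groupCohomology ((invariantsQuotFunctor k (Ū : Subgroup (Γ ⧸ N))).obj Y) n),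
      inflG Ū Y n c = x ∧
      inflExtHomTriv N Y n x =
        inflG (stagePreimage N Ū) ((inflQuotFunctor k N).obj Y) n
          (stageG N (stagePreimage N Ū) Ū le_rfl Y n c) := by
  obtain ⟨Ū, c, rfl⟩ := exists_inflG_eq n Y x
  exact ⟨Ū, c, rfl, inflExtHomTriv_inflG N _ Ū le_rfl Y n c⟩

end LayerColimit

end DiscreteRep

end Literature.Algebra.Homology

end
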